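import Summits.QuantumFields.YangMills.Theorems.BalabanUVNodesN15PerCubeGreenTwoGridSummandPieceDefect
import Summits.QuantumFields.YangMills.Theorems.BalabanUVNodesN15FirstOrderDefect
import Summits.QuantumFields.YangMills.Theorems.BalabanUVNodesN15PartitionLattice
import Summits.QuantumFields.YangMills.Theorems.BalabanUVNodesN15PerCubeGreenTwoGridEntryThreeAlgebra
import Summits.QuantumFields.YangMills.Theorems.BalabanUVNodesN15PerCubeGreenCutGramTwoGridDefect
import Summits.QuantumFields.YangMills.Theorems.BalabanUVNodesN15PerCubeGreenTwoGridNonlocalRow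
import Summits.QuantumFields.YangMills.Theorems.BalabanUVNodesN15PerCubeGreenTwoGridCutRows
import Summits.QuantumFields.YangMills.Theorems.BalabanUVNodesN15CurvedGluingLocalGaugesTwoGridTwisted
import Summits.QuantumFields.YangMills.Theorems.BalabanUVNodesN15CovariantTwoGridPullbackTwistData
import Summits.QuantumFields.YangMills.Theorems.BalabanUVNodesN15NeumannCubeDefect
import HarnessLib

/-!
# N15 = NE2, road (c) — PROGRAMME (PC), TOWARDS ENTRY 3 OF (3.42) WITHOUT JETS: THE TWO-GRID η-DEFECT OF BAŁABAN's COVARIANT AVERAGING SUMMAND THROUGH `τ_S` — n15-c∕376's located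
# row `𝔇_{τ_S}(P′, P)`, PRODUCED from the cube-gauge letters on the plateau blocks: `P = Σ_k (M_{ψ_k}PM_{h_k})M_{h_k}` (block-diagonality + `Σ_k h_k² = 1`), the cube pieces by n15-c∕378,
# the partition's own twisted defect by n15-c∕333, summed over the `(2L)^{d+1}` cube classes (dag-n15-c g34, n15-c∕379)

Cell `pub-ymgap`, seat `pub-ymgap-dag-n15-c` (generation g34; R134 (a) seat, strategy s1 «first missing estimate»; HUMAN RULING D-0062; chair R424 venue).
`bears_on: R4∕N15 · K3⁸ SpineGivenEndpointR13SepCoPHV (stmt-QuantumFields-27366)`; filed `--kind proof --supports stmt-QuantumFields-27366 --as helper` — COUNT-NEUTRAL.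
Theorems only, 0 `def`, 0 `sorry`.  Imports BY NAME n15-c∕378 `…SummandPieceDefect` (`hasMaj_idef_ctauS_scP_piece`), n15-a `…FirstOrderDefect` (`DerivDefect.idef_finset_sum`, `DerivDefect.hasMaj_finset_sum`),
n15-c `…PartitionLattice` (`sum_hcube_sq`: `Σ_k h_k² = 1`), and through 378: n15-c∕377 (`hasMaj_scP'_of_unitary`), 333 (`hasMaj_idef_mulOp_tr`), 336 (`ctauS_eq_mmulOp_pull`, `abs_kingStairT_transpose_le_one`),
198∕265′ (`one_sub_mulOp_comp_mulVecLin_comp_mulOp_eq_zero(′)`: block-diagonality + plateau), the cover's cut rows.  Nothing in the tree is modified, no landed name re-declared.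

WHAT.  ★ `scP_decomp` ∕ `scP'_decomp`: `P = Σ_k (M_{ψ_k}∘P∘M_{h_k})∘M_{h_k}` on both grids — the summand is block-diagonal (`csavg` vanishes across unit blocks: `csavgSq_apply_of_blockOf_ne`), the plateau
`ψ_k ≡ 1` on every block meeting `supp h_k` (`scPsi(′)_eq_one_of_scH(′)_ne_zero_of_blockOf_eq`), and `Σ_k h_k² = 1`.  ★★★ `hasMaj_idef_ctauS_scP` — for unitary cube gauges `u′`, a unitary fine bond
field `U′`, the coarse field = straight fine holonomies, the letters `ρ, b` of the cube-gauged fine field on the plateau blocks and the cover's cut algebra `M_χM_h = M_h` on both grids: the two-grid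
η-defect of the WHOLE summand through the (PC-E) transport, `𝔇_{τ_S}(P′(U′), P(U)) ≤ |K|·(a₀|ι|³·o_h + |ι|²(m + 2s·a₀|ι|²))·e^{−δd}` (`|K| = (2L)^{d+1}` cube classes, `o_h = π(d+1)∕(L^kL^{m_v})` the partition's
two-grid fit, `m, s` as in n15-c∕378) — per cube `𝔇(A′_kM_{h′_k}, A_kM_{h_k}) = A′_k𝔇(M_{h′_k}, M_{h_k}) + 𝔇(A′_k, A_k)M_{h_k}` (`idef_comp`; rows 377+333 and 378), then `hasMaj_finset_sum`.  This IS the row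
`hDP` of n15-c∕376 `hasMaj_idef_entryThree` — `O(L^{−2k}) + O(η(p+q)) + O((L^kL^{m_v})^{−1})`, UNIFORM in the fine spacing; the window `m₀ + 2w + 1 ≤ Lw` is DERIVED from `hm₁`, `hfitI`.

HONEST FRAMING ∕ LIMITS.  Bookkeeping over landed rows in the MODEL two-grid setting (King tori, straight-holonomy pairing, one cube scale); the letters are the (3.35) letters in the cube
gauges (produced per cube from the datum by n15-c∕346∕360∕370); the `|K|`-fold overcount is the crude union bound (the pieces are in fact `R`-local — not used); nothing of [B9] asserted
((3.19) p.393, (3.24) p.394, (3.32) p.395 = SHAPES).  What entry 3 still needs after this file: the decay of the coarse glued Green's function and the two inverse identities WITH THE PRODUCED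
gauges (dag-n15-w3 52 ∕ `uN_scGlued_spec` threaded through n15-c∕340's letter production), then n15-c∕376.  NE2⁺ NOT PRINTED ∕ NOT proved; N15 of record untouched (DISCHARGED AS CONSUMED,
p687738); K3⁸ OPEN; counts of record UNMOVED (typed 28∕28 · discharged 8∕27); one finite 𝕋⁴ at fixed ε per index — NOT infinite volume, NOT OS on ℝ⁴, NOT a mass gap, NOT Clay.  Restate-immune.
-/


set_option autoImplicit false

noncomputable section

open scoped BigOperators Matrix Matrix.Norms.L2Operator
open Finset

namespace Summit.QuantumFields.YangMills.BalabanUVNodes.N15.Gluing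

open Real
open Literature.MathematicalPhysics.QuantumFieldTheory.Balaban1983to89
open Literature.MathematicalPhysics.QuantumFieldTheory.Balaban1983to89.B5Prop11Plancherel (Tor fine unitVec)
open Literature.MathematicalPhysics.QuantumFieldTheory.Balaban1983to89.B11SectG (BlockNorm HasMaj)
open Literature.MathematicalPhysics.QuantumFieldTheory.Balaban1983to89.T4EtaRateDefect (idef idef_sub idef_comp)
open Literature.MathematicalPhysics.QuantumFieldTheory.Balaban1983to89.T4EtaRateCoeffDefect (diagK diagK_same diagK_ne diagK_nonneg)
open Literature.MathematicalPhysics.QuantumFieldTheory.Balaban1983to89.T4EtaRateCoeffDefect (pull)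
open Literature.MathematicalPhysics.QuantumFieldTheory.Balaban1983to89.B6Prop26Gluing (mulOp mulOp_apply ind ind_of_mem ind_nonneg)
open Literature.MathematicalPhysics.QuantumFieldTheory.Balaban1983to89.B6UnitTorusCarrier (unitTorusGeo)
open Literature.MathematicalPhysics.QuantumFieldTheory.King1986 (aK aK_pos aK_le)
open Literature.Barriers.QuantumFields (traceForm)
open Summit.QuantumFields.YangMills.BalabanUVNodes.N15.VectorPiece (kingPr)
open Summit.QuantumFields.YangMills.BalabanUVNodes.N15.MatrixSpecies (mmulOp mmulOp_comp_mmulOp coordMat basisConst basisConst_nonneg liftBlk liftMap)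
open Summit.QuantumFields.YangMills.BalabanUVNodes.N15.CurvedSpecies (cutDefect_of_localGauge_tr hasMaj_idef_mulOp_tr pull_comp_mulOp_fst mulOp_fst_comp_mmulOp_smul mmulOp_comp_mulOp_fst_smul mmulOp_one
  uN_coordMat_conj_orthogonal uN_gaugeTransformed_bond_unitary uN_abs_coordMat_conj_sub_one_entry_le_op)
open Summit.QuantumFields.YangMills.BalabanUVNodes.N15.CovLandau (gaugeT)
open Summit.QuantumFields.YangMills.BalabanUVNodes.N15.CovAvg (mprod kingSec ctauS kingStairT ctauS_eq_conj_gaugeT ctauS_eq_mmulOp_pull abs_kingStairT_transpose_le_one smear_cols_kingStairT_transpose_sub_one_le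
  smear_cols_kingStairT_transpose_sub_one_le_kingPr conjTranspose_mprod_mul_self blockOf_kingPr)
open Summit.QuantumFields.YangMills.BalabanUVNodes.N15.TwoGrid (hasMaj_mulOp_comp_of_abs_le_one abs_chiCube_le_one chiCube cubeBlocks chiCube_of_not_mem)
open Summit.QuantumFields.YangMills.BalabanUVNodes.N15.CovLandau (csavg)

variable {d : ℕ} {L : ℕ} [NeZero L] {mv kk r : ℕ} {hL : Odd L ∧ 1 < L} {mm : Type} [Fintype mm] [DecidableEq mm] [Nonempty mm] (ι : Type) [Fintype ι] [DecidableEq ι]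
  (e : Matrix mm mm ℂ ≃L[ℝ] (ι → ℝ))

variable (hM : ∀ ν, cvM d L mv kk hL ν = 2 * L * L ^ mv) (hm₁ : 2 * L ^ mv ≤ coverMargin L mv) (hfitI : coverMargin L mv - 2 * L ^ mv + (6 * L ^ mv + 1) ≤ L * L ^ mv)
  (hS0 : L * L ^ mv ≤ 2 * L * L ^ mv) (hw : 0 < L ^ mv) (hfit : coverMargin L mv + 2 * L ^ mv + 1 ≤ L * L ^ mv)

/-! ## §1 The decomposition of the summand along the cover -/

/-- the summand's matrix vanishes across unit blocks (block-diagonality of `a·Q′_Tᵀ Q′_T`). [cite: Balaban1985BackgroundPropagators, (3.19) p.393, (3.24) p.394 (block structure: shape)] -/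
theorem csavgSq_apply_of_blockOf_ne {M : Fin (d + 1) → ℕ} [∀ μ, NeZero (M μ)] {n : ℕ} [NeZero n] (a : ℝ) (T : Fin (d + 1) → Tor (fine n M) → Matrix ι ι ℝ)
    (p q : Tor (fine n M) × ι) (h : Literature.MathematicalPhysics.QuantumFieldTheory.King1986.Torus.blockOf n M q.1 ≠ Literature.MathematicalPhysics.QuantumFieldTheory.King1986.Torus.blockOf n M p.1) :
    (a • ((csavg M n T)ᵀ * csavg M n T)) p q = 0 := by
  rw [Matrix.smul_apply, Matrix.mul_apply, Finset.sum_eq_zero, smul_zero]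
  intro c _
  rw [Matrix.transpose_apply]
  by_cases hp : Literature.MathematicalPhysics.QuantumFieldTheory.King1986.Torus.blockOf n M p.1 = c.1
  · have hq : ¬ Literature.MathematicalPhysics.QuantumFieldTheory.King1986.Torus.blockOf n M q.1 = c.1 := fun hq => h (hq.trans hp.symm)
    rw [show csavg M n T c q = 0 from if_neg hq, mul_zero]
  · rw [show csavg M n T c p = 0 from if_neg hp, zero_mul]

include hM hw hfit in
/-- the fine plateau `ψ′_k` is `1` on every fine site whose unit block meets `supp h′_k`. [cite: Balaban1984PropagatorsII, (2.36)–(2.37) p.229 (supp h_□ ⊂ □: shape)] -/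
theorem scPsi'_eq_one_of_scH'_ne_zero_of_blockOf_eq (k : (Fin (d + 1) → ZMod (2 * L))) (x x' : ScX' d L mv kk r hL) (hx' : scH' d L mv kk r hL k x' ≠ 0)
    (hb : Literature.MathematicalPhysics.QuantumFieldTheory.King1986.Torus.blockOf (L ^ r * L ^ kk) (cvM d L mv kk hL) x' = Literature.MathematicalPhysics.QuantumFieldTheory.King1986.Torus.blockOf (L ^ r * L ^ kk) (cvM d L mv kk hL) x) :
    scPsi' d L mv kk r hL k x = 1 := by
  have h1 : scPsi' d L mv kk r hL k x' = 1 :=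
    chiCube_coverCorner_eq_one hM hw hfit 0 k (x', 0) ⟨(x', 0), Or.inl rfl, abs_cenRep_lt_one_of_hcube_ne_zero (2 * L) (coverXi (cvM d L mv kk hL) (L ^ r * L ^ kk) (L ^ mv)) hx'⟩
  have h1' : Literature.MathematicalPhysics.QuantumFieldTheory.King1986.Torus.blockOf (L ^ r * L ^ kk) (cvM d L mv kk hL) x' ∈ cubeBlocks (cvM d L mv kk hL) (coverCorner (cvM d L mv kk hL) (L ^ mv) L (coverMargin L mv) k) (L * L ^ mv) := by
    by_contra hnot; exact one_ne_zero (h1.symm.trans (chiCube_of_not_mem hnot))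
  show chiCube (cvM d L mv kk hL) (L ^ r * L ^ kk) (coverCorner (cvM d L mv kk hL) (L ^ mv) L (coverMargin L mv) k) (L * L ^ mv) (x, 0) = 1
  unfold chiCube
  rw [if_pos]
  show Literature.MathematicalPhysics.QuantumFieldTheory.King1986.Torus.blockOf (L ^ r * L ^ kk) (cvM d L mv kk hL) x ∈ cubeBlocks (cvM d L mv kk hL) (coverCorner (cvM d L mv kk hL) (L ^ mv) L (coverMargin L mv) k) (L * L ^ mv)
  rw [← hb]; exact h1'

include hM hw hfit in
/-- coarse twin of `scPsi'_eq_one_of_scH'_ne_zero_of_blockOf_eq`. [cite: Balaban1984PropagatorsII, (2.36)–(2.37) p.229 (shape)] -/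
theorem scPsi_eq_one_of_scH_ne_zero_of_blockOf_eq (k : (Fin (d + 1) → ZMod (2 * L))) (x x' : ScX d L mv kk hL) (hx' : scH d L mv kk hL k x' ≠ 0)
    (hb : Literature.MathematicalPhysics.QuantumFieldTheory.King1986.Torus.blockOf (L ^ kk) (cvM d L mv kk hL) x' = Literature.MathematicalPhysics.QuantumFieldTheory.King1986.Torus.blockOf (L ^ kk) (cvM d L mv kk hL) x) :
    scPsi d L mv kk hL k x = 1 := by
  have h1 : scPsi d L mv kk hL k x' = 1 :=
    chiCube_coverCorner_eq_one hM hw hfit 0 k (x', 0) ⟨(x', 0), Or.inl rfl, abs_cenRep_lt_one_of_hcube_ne_zero (2 * L) (coverXi (cvM d L mv kk hL) (L ^ kk) (L ^ mv)) hx'⟩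
  have h1' : Literature.MathematicalPhysics.QuantumFieldTheory.King1986.Torus.blockOf (L ^ kk) (cvM d L mv kk hL) x' ∈ cubeBlocks (cvM d L mv kk hL) (coverCorner (cvM d L mv kk hL) (L ^ mv) L (coverMargin L mv) k) (L * L ^ mv) := by
    by_contra hnot; exact one_ne_zero (h1.symm.trans (chiCube_of_not_mem hnot))
  show chiCube (cvM d L mv kk hL) (L ^ kk) (coverCorner (cvM d L mv kk hL) (L ^ mv) L (coverMargin L mv) k) (L * L ^ mv) (x, 0) = 1
  unfold chiCube
  rw [if_pos]
  show Literature.MathematicalPhysics.QuantumFieldTheory.King1986.Torus.blockOf (L ^ kk) (cvM d L mv kk hL) x ∈ cubeBlocks (cvM d L mv kk hL) (coverCorner (cvM d L mv kk hL) (L ^ mv) L (coverMargin L mv) k) (L * L ^ mv)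
  rw [← hb]; exact h1'

omit [Nonempty mm] in
include hM hw hfit in
/-- ★ **THE DECOMPOSITION OF THE SUMMAND ALONG THE COVER, fine grid**: `P′ = Σ_k (M_{ψ′_k}P′M_{h′_k})M_{h′_k}` — block-diagonality, the plateau, `Σ_k h_k² = 1`.
[cite: Balaban1984PropagatorsII, (2.36)–(2.37) p.229, (2.133) p.247 (shape); Balaban1985BackgroundPropagators, (3.24) p.394 (shape)] -/
theorem scP'_decomp (hK2 : 2 ≤ 2 * L) (a : ℝ) (U' : Fin (d + 1) → ScX' d L mv kk r hL → Matrix mm mm ℂ) :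
    scP' d L mv kk r hL a ι e U' = ∑ k : (Fin (d + 1) → ZMod (2 * L)), (mulOp (fun p : ScX' d L mv kk r hL × ι => scPsi' d L mv kk r hL k p.1) ∘ₗ (scP' d L mv kk r hL a ι e U' ∘ₗ mulOp (fun p : ScX' d L mv kk r hL × ι => scH' d L mv kk r hL k p.1))) ∘ₗ mulOp (fun p : ScX' d L mv kk r hL × ι => scH' d L mv kk r hL k p.1) := by
  classical
  have hcut : ∀ k : (Fin (d + 1) → ZMod (2 * L)), mulOp (fun p : ScX' d L mv kk r hL × ι => scPsi' d L mv kk r hL k p.1) ∘ₗ (scP' d L mv kk r hL a ι e U' ∘ₗ mulOp (fun p : ScX' d L mv kk r hL × ι => scH' d L mv kk r hL k p.1)) = scP' d L mv kk r hL a ι e U' ∘ₗ mulOp (fun p : ScX' d L mv kk r hL × ι => scH' d L mv kk r hL k p.1) := by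
    intro k
    have h0 : (LinearMap.id - mulOp (fun p : ScX' d L mv kk r hL × ι => scPsi' d L mv kk r hL k p.1)) ∘ₗ scP' d L mv kk r hL a ι e U' ∘ₗ mulOp (fun p : ScX' d L mv kk r hL × ι => scH' d L mv kk r hL k p.1) = 0 :=
      one_sub_mulOp_comp_mulVecLin_comp_mulOp_eq_zero' (ι := ι) _ (fun p q hpq => csavgSq_apply_of_blockOf_ne ι a (cvT e U') p q hpq)
        (fun x x' hx' hb => scPsi'_eq_one_of_scH'_ne_zero_of_blockOf_eq hM hw hfit k x x' hx' hb)
    rw [LinearMap.sub_comp, LinearMap.id_comp, sub_eq_zero] at h0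
    exact h0.symm
  have hsq : ∑ k : (Fin (d + 1) → ZMod (2 * L)), mulOp (fun p : ScX' d L mv kk r hL × ι => scH' d L mv kk r hL k p.1) ∘ₗ mulOp (fun p : ScX' d L mv kk r hL × ι => scH' d L mv kk r hL k p.1) = (LinearMap.id : (ScX' d L mv kk r hL × ι → ℝ) →ₗ[ℝ] (ScX' d L mv kk r hL × ι → ℝ)) := by
    refine LinearMap.ext fun v => funext fun p => ?_
    have h236 : ∑ k : (Fin (d + 1) → ZMod (2 * L)), scH' d L mv kk r hL k p.1 ^ 2 = 1 := sum_hcube_sq (2 * L) (scXi' d L mv kk r hL) hK2 p.1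
    simp only [LinearMap.sum_apply, Finset.sum_apply, LinearMap.comp_apply, mulOp_apply, LinearMap.id_apply]
    simp only [← mul_assoc]
    rw [← Finset.sum_mul]
    simp only [← pow_two]
    rw [h236, one_mul]
  calc scP' d L mv kk r hL a ι e U' = scP' d L mv kk r hL a ι e U' ∘ₗ LinearMap.id := (LinearMap.comp_id _).symm
    _ = scP' d L mv kk r hL a ι e U' ∘ₗ ∑ k : (Fin (d + 1) → ZMod (2 * L)), mulOp (fun p : ScX' d L mv kk r hL × ι => scH' d L mv kk r hL k p.1) ∘ₗ mulOp (fun p : ScX' d L mv kk r hL × ι => scH' d L mv kk r hL k p.1) := by rw [hsq]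
    _ = ∑ k : (Fin (d + 1) → ZMod (2 * L)), scP' d L mv kk r hL a ι e U' ∘ₗ (mulOp (fun p : ScX' d L mv kk r hL × ι => scH' d L mv kk r hL k p.1) ∘ₗ mulOp (fun p : ScX' d L mv kk r hL × ι => scH' d L mv kk r hL k p.1)) := by
          refine LinearMap.ext fun v => ?_
          simp only [LinearMap.comp_apply, LinearMap.sum_apply, map_sum]
    _ = ∑ k : (Fin (d + 1) → ZMod (2 * L)), (mulOp (fun p : ScX' d L mv kk r hL × ι => scPsi' d L mv kk r hL k p.1) ∘ₗ (scP' d L mv kk r hL a ι e U' ∘ₗ mulOp (fun p : ScX' d L mv kk r hL × ι => scH' d L mv kk r hL k p.1))) ∘ₗ mulOp (fun p : ScX' d L mv kk r hL × ι => scH' d L mv kk r hL k p.1) := by simp only [hcut, LinearMap.comp_assoc]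

omit [Nonempty mm] in
include hM hw hfit in
/-- ★ **THE DECOMPOSITION OF THE SUMMAND ALONG THE COVER, coarse grid**: `P = Σ_k (M_{ψ_k}PM_{h_k})M_{h_k}`. [cite: Balaban1984PropagatorsII, (2.36)–(2.37) p.229, (2.133) p.247 (shape)] -/
theorem scP_decomp (hK2 : 2 ≤ 2 * L) (a : ℝ) (U : Fin (d + 1) → ScX d L mv kk hL → Matrix mm mm ℂ) :
    scP d L mv kk hL a ι e U = ∑ k : (Fin (d + 1) → ZMod (2 * L)), (mulOp (fun p : ScX d L mv kk hL × ι => scPsi d L mv kk hL k p.1) ∘ₗ (scP d L mv kk hL a ι e U ∘ₗ mulOp (fun p : ScX d L mv kk hL × ι => scH d L mv kk hL k p.1))) ∘ₗ mulOp (fun p : ScX d L mv kk hL × ι => scH d L mv kk hL k p.1) := by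
  classical
  have hcut : ∀ k : (Fin (d + 1) → ZMod (2 * L)), mulOp (fun p : ScX d L mv kk hL × ι => scPsi d L mv kk hL k p.1) ∘ₗ (scP d L mv kk hL a ι e U ∘ₗ mulOp (fun p : ScX d L mv kk hL × ι => scH d L mv kk hL k p.1)) = scP d L mv kk hL a ι e U ∘ₗ mulOp (fun p : ScX d L mv kk hL × ι => scH d L mv kk hL k p.1) := by
    intro k
    have h0 : (LinearMap.id - mulOp (fun p : ScX d L mv kk hL × ι => scPsi d L mv kk hL k p.1)) ∘ₗ scP d L mv kk hL a ι e U ∘ₗ mulOp (fun p : ScX d L mv kk hL × ι => scH d L mv kk hL k p.1) = 0 :=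
      one_sub_mulOp_comp_mulVecLin_comp_mulOp_eq_zero (ι := ι) _ (fun p q hpq => csavgSq_apply_of_blockOf_ne ι a (cvT e U) p q hpq)
        (fun x x' hx' hb => scPsi_eq_one_of_scH_ne_zero_of_blockOf_eq hM hw hfit k x x' hx' hb)
    rw [LinearMap.sub_comp, LinearMap.id_comp, sub_eq_zero] at h0
    exact h0.symm
  have hsq : ∑ k : (Fin (d + 1) → ZMod (2 * L)), mulOp (fun p : ScX d L mv kk hL × ι => scH d L mv kk hL k p.1) ∘ₗ mulOp (fun p : ScX d L mv kk hL × ι => scH d L mv kk hL k p.1) = (LinearMap.id : (ScX d L mv kk hL × ι → ℝ) →ₗ[ℝ] (ScX d L mv kk hL × ι → ℝ)) := by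
    refine LinearMap.ext fun v => funext fun p => ?_
    have h236 : ∑ k : (Fin (d + 1) → ZMod (2 * L)), scH d L mv kk hL k p.1 ^ 2 = 1 := sum_hcube_sq (2 * L) (scXi d L mv kk hL) hK2 p.1
    simp only [LinearMap.sum_apply, Finset.sum_apply, LinearMap.comp_apply, mulOp_apply, LinearMap.id_apply]
    simp only [← mul_assoc]
    rw [← Finset.sum_mul]
    simp only [← pow_two]
    rw [h236, one_mul]
  calc scP d L mv kk hL a ι e U = scP d L mv kk hL a ι e U ∘ₗ LinearMap.id := (LinearMap.comp_id _).symm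
    _ = scP d L mv kk hL a ι e U ∘ₗ ∑ k : (Fin (d + 1) → ZMod (2 * L)), mulOp (fun p : ScX d L mv kk hL × ι => scH d L mv kk hL k p.1) ∘ₗ mulOp (fun p : ScX d L mv kk hL × ι => scH d L mv kk hL k p.1) := by rw [hsq]
    _ = ∑ k : (Fin (d + 1) → ZMod (2 * L)), scP d L mv kk hL a ι e U ∘ₗ (mulOp (fun p : ScX d L mv kk hL × ι => scH d L mv kk hL k p.1) ∘ₗ mulOp (fun p : ScX d L mv kk hL × ι => scH d L mv kk hL k p.1)) := by
          refine LinearMap.ext fun v => ?_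
          simp only [LinearMap.comp_apply, LinearMap.sum_apply, map_sum]
    _ = ∑ k : (Fin (d + 1) → ZMod (2 * L)), (mulOp (fun p : ScX d L mv kk hL × ι => scPsi d L mv kk hL k p.1) ∘ₗ (scP d L mv kk hL a ι e U ∘ₗ mulOp (fun p : ScX d L mv kk hL × ι => scH d L mv kk hL k p.1))) ∘ₗ mulOp (fun p : ScX d L mv kk hL × ι => scH d L mv kk hL k p.1) := by simp only [hcut, LinearMap.comp_assoc]

/-! ## §2 The two-grid defect of the whole summand through `τ_S` -/

include hM hm₁ hfitI hS0 hw in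
set_option maxHeartbeats 800000 in
/-- ★★★ **THE TWO-GRID η-DEFECT OF BAŁABAN's COVARIANT AVERAGING SUMMAND THROUGH `τ_S`, from the cube-gauge letters** — see the module docstring: the row `hDP` of n15-c∕376
`hasMaj_idef_entryThree`. [cite: Balaban1985BackgroundPropagators, (3.19) p.393, (3.24) p.394, (3.32)–(3.35) pp.395–396, (3.62)–(3.65) pp.402–403 (shapes ∕ mechanism); Balaban1984PropagatorsII,
(2.36)–(2.37) p.229, (2.133) p.247; King1986, p.664 (pairing convention)] -/
theorem hasMaj_idef_ctauS_scP (hL2 : (2 : ℝ) ≤ (L : ℝ)) (hkk : 1 ≤ kk) (he : ∀ A B : Matrix mm mm ℂ, traceForm A B = e A ⬝ᵥ e B) {a₀ : ℝ} (ha₀ : 0 < a₀)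
    (u' : (Fin (d + 1) → ZMod (2 * L)) → ScX' d L mv kk r hL → Matrix mm mm ℂ) (hu' : ∀ k z, (u' k z)ᴴ * u' k z = 1)
    (U' : Fin (d + 1) → ScX' d L mv kk r hL → Matrix mm mm ℂ) (hU' : ∀ μ z, (U' μ z)ᴴ * U' μ z = 1) (U : Fin (d + 1) → ScX d L mv kk hL → Matrix mm mm ℂ)
    (hpair : ∀ μ y, U μ y = mprod (fun t => U' μ (kingSec (cvM d L mv kk hL) L kk r y + t • unitVec (fine (L ^ r * L ^ kk) (cvM d L mv kk hL)) μ)) (L ^ r))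
    {ρ b : ℝ} (hρ : 0 ≤ ρ) (hb : 0 ≤ b)
    (hρk : ∀ k μ (z : ScX' d L mv kk r hL), scBlk' d L mv kk r hL z ∈ cvSk d L mv kk hL k → ‖u' k z * U' μ z * (u' k (scShift' d L mv kk r hL μ z))ᴴ - 1‖ ≤ ρ)
    (hbk : ∀ k κ μ (z : ScX' d L mv kk r hL), scBlk' d L mv kk r hL z ∈ cvSk d L mv kk hL k →
      ‖u' k (z + unitVec (fine (L ^ r * L ^ kk) (cvM d L mv kk hL)) κ) * U' μ (z + unitVec (fine (L ^ r * L ^ kk) (cvM d L mv kk hL)) κ) * (u' k ((z + unitVec (fine (L ^ r * L ^ kk) (cvM d L mv kk hL)) κ) + unitVec (fine (L ^ r * L ^ kk) (cvM d L mv kk hL)) μ))ᴴ - (u' k z * U' μ z * (u' k (z + unitVec (fine (L ^ r * L ^ kk) (cvM d L mv kk hL)) μ))ᴴ)‖ ≤ b)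
    {δ : ℝ} (hδ : 0 ≤ δ)
    -- the cut algebra of the cover on both grids: `M_χM_h = M_h` (dag-n15-w3 52's `hχh`, n15-c∕339's `hχhf`)
    (hχh : ∀ k : (Fin (d + 1) → ZMod (2 * L)), mulOp (fun p : ScX d L mv kk hL × ι => scChi d L mv kk hL k p.1) ∘ₗ mulOp (fun p : ScX d L mv kk hL × ι => scH d L mv kk hL k p.1) = mulOp (fun p : ScX d L mv kk hL × ι => scH d L mv kk hL k p.1))
    (hχh' : ∀ k : (Fin (d + 1) → ZMod (2 * L)), mulOp (fun p : ScX' d L mv kk r hL × ι => scChi' d L mv kk r hL k p.1) ∘ₗ mulOp (fun p : ScX' d L mv kk r hL × ι => scH' d L mv kk r hL k p.1) = mulOp (fun p : ScX' d L mv kk r hL × ι => scH' d L mv kk r hL k p.1)) :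
    HasMaj (ScNorm d L mv kk hL ι) (BlockNorm.ofBlocks (unitTorusGeo L kk (cvM d L mv kk hL)) (liftBlk (scBlk d L mv kk hL ∘ kingPr L kk r (cvM d L mv kk hL)) ι))
      (idef (ctauS (cvM d L mv kk hL) L kk r (cvT e U')) (ctauS (cvM d L mv kk hL) L kk r (cvT e U')) (scP' d L mv kk r hL (aK a₀ (L : ℝ) (r + kk) * (((L ^ r * L ^ kk : ℕ) : ℝ)) ^ (d + 1)) ι e U') (scP d L mv kk hL (aK a₀ (L : ℝ) kk * (((L ^ kk : ℕ) : ℝ)) ^ (d + 1)) ι e U))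
      (fun y y' => (Fintype.card (Fin (d + 1) → ZMod (2 * L)) : ℝ) * (((a₀ * (Fintype.card ι : ℝ) ^ 2) * (Fintype.card ι * (Real.pi * (d + 1) / (((L ^ kk : ℕ) : ℝ) * ((L ^ mv : ℕ) : ℝ))))) + ((Fintype.card ι : ℝ) ^ 2 * (((4 / 3 * a₀ * ((L : ℝ) ^ kk) ^ (-(2 : ℝ))) + (Fintype.card ι * (|aK a₀ (L : ℝ) (r + kk) - aK a₀ (L : ℝ) kk| * (1 + Fintype.card ι) + |aK a₀ (L : ℝ) kk| * (2 * Fintype.card ι * (@basisConst ι _ (Matrix mm mm ℂ) Matrix.frobeniusNormedAddCommGroup Matrix.frobeniusNormedSpace e * (2 * Real.sqrt (Fintype.card mm)) * (Real.sqrt (Fintype.card mm) * ((d + 1) * (d * ((((L ^ r * L ^ kk : ℕ) : ℝ)) * (((L ^ r : ℕ) : ℝ) * b)) + ((1 + ρ) ^ (L ^ r) - 1)))))))) + ((a₀ * (Fintype.card ι : ℝ) ^ 2) * (Fintype.card ι * (Real.pi * (d + 1) / (((L ^ kk : ℕ) : ℝ) * ((L ^ mv : ℕ) : ℝ)))))) +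 ((1 + (Fintype.card ι * (@basisConst ι _ (Matrix mm mm ℂ) Matrix.frobeniusNormedAddCommGroup Matrix.frobeniusNormedSpace e * (2 * Real.sqrt (Fintype.card mm)) * (Real.sqrt (Fintype.card mm) * ρ)))) ^ ((d + 1) * (L ^ r - 1)) - 1) * (a₀ * (Fintype.card ι : ℝ) ^ 2) + ((1 + (Fintype.card ι * (@basisConst ι _ (Matrix mm mm ℂ) Matrix.frobeniusNormedAddCommGroup Matrix.frobeniusNormedSpace e * (2 * Real.sqrt (Fintype.card mm)) * (Real.sqrt (Fintype.card mm) * ρ)))) ^ ((d + 1) * (L ^ r - 1)) - 1) * (a₀ * (Fintype.card ι : ℝ) ^ 2)))) * Real.exp (-(δ * (unitTorusGeo L kk (cvM d L mv kk hL)).dist y y'))) := by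
  classical
  have hK2 : 2 ≤ 2 * L := by have := hL.2; omega
  have hfit : coverMargin L mv + 2 * L ^ mv + 1 ≤ L * L ^ mv := by omega
  -- numerics
  have hLpos : 0 < L := Nat.pos_of_ne_zero (NeZero.ne L)
  have hL1 : (1 : ℝ) < (L : ℝ) := by exact_mod_cast hL.2
  have hLr : 0 < L ^ r := pow_pos hLpos r
  have hrk : 1 ≤ r + kk := le_add_left hkk
  have hnc0 : (0 : ℝ) < ((L ^ kk : ℕ) : ℝ) := by exact_mod_cast pow_pos hLpos kk
  have hnf0 : (0 : ℝ) < ((L ^ r * L ^ kk : ℕ) : ℝ) := by exact_mod_cast Nat.mul_pos hLr (pow_pos hLpos kk)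
  have hw0 : (0 : ℝ) < ((L ^ mv : ℕ) : ℝ) := by exact_mod_cast hw
  have hκ := @basisConst_nonneg ι _ (Matrix mm mm ℂ) Matrix.frobeniusNormedAddCommGroup Matrix.frobeniusNormedSpace e
  have hι0 : (0 : ℝ) ≤ Fintype.card ι := Nat.cast_nonneg _
  have haK' : 0 < aK a₀ (L : ℝ) (r + kk) := aK_pos ha₀ hL1 hrk
  have haKle' : aK a₀ (L : ℝ) (r + kk) ≤ a₀ := aK_le ha₀ hL1 hrk
  have hρ1 : (0 : ℝ) ≤ (Fintype.card ι * (@basisConst ι _ (Matrix mm mm ℂ) Matrix.frobeniusNormedAddCommGroup Matrix.frobeniusNormedSpace e * (2 * Real.sqrt (Fintype.card mm)) * (Real.sqrt (Fintype.card mm) * ρ))) := by positivity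
  have hs0 : (0 : ℝ) ≤ ((1 + (Fintype.card ι * (@basisConst ι _ (Matrix mm mm ℂ) Matrix.frobeniusNormedAddCommGroup Matrix.frobeniusNormedSpace e * (2 * Real.sqrt (Fintype.card mm)) * (Real.sqrt (Fintype.card mm) * ρ)))) ^ ((d + 1) * (L ^ r - 1)) - 1) := by
    have := one_le_pow₀ (M₀ := ℝ) (a := 1 + (Fintype.card ι * (@basisConst ι _ (Matrix mm mm ℂ) Matrix.frobeniusNormedAddCommGroup Matrix.frobeniusNormedSpace e * (2 * Real.sqrt (Fintype.card mm)) * (Real.sqrt (Fintype.card mm) * ρ)))) (le_add_of_nonneg_right hρ1) (n := (d + 1) * (L ^ r - 1)); linarith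
  have hρL : (0 : ℝ) ≤ ((1 + ρ) ^ (L ^ r) - 1) := by have := one_le_pow₀ (M₀ := ℝ) (a := 1 + ρ) (le_add_of_nonneg_right hρ) (n := L ^ r); linarith
  have hON0 : (0 : ℝ) ≤ (Fintype.card ι * (|aK a₀ (L : ℝ) (r + kk) - aK a₀ (L : ℝ) kk| * (1 + Fintype.card ι) + |aK a₀ (L : ℝ) kk| * (2 * Fintype.card ι * (@basisConst ι _ (Matrix mm mm ℂ) Matrix.frobeniusNormedAddCommGroup Matrix.frobeniusNormedSpace e * (2 * Real.sqrt (Fintype.card mm)) * (Real.sqrt (Fintype.card mm) * ((d + 1) * (d * ((((L ^ r * L ^ kk : ℕ) : ℝ)) * (((L ^ r : ℕ) : ℝ) * b)) + ((1 + ρ) ^ (L ^ r) - 1)))))))) := by positivity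
  have hOHo0 : (0 : ℝ) ≤ (Real.pi * (d + 1) / (((L ^ kk : ℕ) : ℝ) * ((L ^ mv : ℕ) : ℝ))) := by positivity
  have hPIECE0 : (0 : ℝ) ≤ ((Fintype.card ι : ℝ) ^ 2 * (((4 / 3 * a₀ * ((L : ℝ) ^ kk) ^ (-(2 : ℝ))) + (Fintype.card ι * (|aK a₀ (L : ℝ) (r + kk) - aK a₀ (L : ℝ) kk| * (1 + Fintype.card ι) + |aK a₀ (L : ℝ) kk| * (2 * Fintype.card ι * (@basisConst ι _ (Matrix mm mm ℂ) Matrix.frobeniusNormedAddCommGroup Matrix.frobeniusNormedSpace e * (2 * Real.sqrt (Fintype.card mm)) * (Real.sqrt (Fintype.card mm) * ((d + 1) * (d * ((((L ^ r * L ^ kk : ℕ) : ℝ)) * (((L ^ r : ℕ) : ℝ) * b)) + ((1 + ρ) ^ (L ^ r) - 1)))))))) + ((a₀ * (Fintype.card ι : ℝ) ^ 2) * (Fintype.card ι * (Real.pi * (d + 1) / (((L ^ kk : ℕ) : ℝ) * ((L ^ mv : ℕ) : ℝ)))))) + ((1 + (Fintype.card ι * (@basisConst ι _ (Matrix mm mm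 ℂ) Matrix.frobeniusNormedAddCommGroup Matrix.frobeniusNormedSpace e * (2 * Real.sqrt (Fintype.card mm)) * (Real.sqrt (Fintype.card mm) * ρ)))) ^ ((d + 1) * (L ^ r - 1)) - 1) * (a₀ * (Fintype.card ι : ℝ) ^ 2) + ((1 + (Fintype.card ι * (@basisConst ι _ (Matrix mm mm ℂ) Matrix.frobeniusNormedAddCommGroup Matrix.frobeniusNormedSpace e * (2 * Real.sqrt (Fintype.card mm)) * (Real.sqrt (Fintype.card mm) * ρ)))) ^ ((d + 1) * (L ^ r - 1)) - 1) * (a₀ * (Fintype.card ι : ℝ) ^ 2))) := by positivity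
  have hE1 : ∀ y y' : Tor (cvM d L mv kk hL), Real.exp (-(δ * (unitTorusGeo L kk (cvM d L mv kk hL)).dist y y')) ≤ 1 := fun y y' => by
    rw [Real.exp_le_one_iff]; exact neg_nonpos.mpr (mul_nonneg hδ (Literature.MathematicalPhysics.QuantumFieldTheory.Balaban1983to89.B6UnitTorusCarrier.unitTorusGeo_dist_nonneg L kk (cvM d L mv kk hL) y y'))
  have hEXP0 : ∀ y y' : Tor (cvM d L mv kk hL), (0 : ℝ) ≤ (a₀ * (Fintype.card ι : ℝ) ^ 2) * Real.exp (-(δ * (unitTorusGeo L kk (cvM d L mv kk hL)).dist y y')) := fun y y' => by positivity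
  have hind : ∀ y : Tor (cvM d L mv kk hL), ind (g := unitTorusGeo L kk (cvM d L mv kk hL)) (Set.univ : Set (Tor (cvM d L mv kk hL))) y = 1 := fun y => ind_of_mem (g := unitTorusGeo L kk (cvM d L mv kk hL)) (Set.mem_univ y)
  have hh1le : ∀ (k : (Fin (d + 1) → ZMod (2 * L))) (p : ScX' d L mv kk r hL × ι), |(fun p : ScX' d L mv kk r hL × ι => scH' d L mv kk r hL k p.1) p| ≤ 1 := fun k p => abs_hcube_le_one (2 * L) (scXi' d L mv kk r hL) k p.1
  have hhle : ∀ (k : (Fin (d + 1) → ZMod (2 * L))) (p : ScX d L mv kk hL × ι), |(fun p : ScX d L mv kk hL × ι => scH d L mv kk hL k p.1) p| ≤ 1 := fun k p => abs_hcube_le_one (2 * L) (scXi d L mv kk hL) k p.1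
  have hψ1le : ∀ (k : (Fin (d + 1) → ZMod (2 * L))) (p : ScX' d L mv kk r hL × ι), |(fun p : ScX' d L mv kk r hL × ι => scPsi' d L mv kk r hL k p.1) p| ≤ 1 := fun k p => abs_chiCube_le_one _ _
  -- (1) the fine summand's row (n15-c∕377, `U′` unitary), read against the target blocks, with the cube's cuts
  have hlift : liftBlk (scBlk' d L mv kk r hL) ι = liftBlk (scBlk d L mv kk hL ∘ kingPr L kk r (cvM d L mv kk hL)) ι := funext fun p => (blockOf_kingPr (cvM d L mv kk hL) L kk r p.1).symm
  have haF : |(aK a₀ (L : ℝ) (r + kk) * (((L ^ r * L ^ kk : ℕ) : ℝ)) ^ (d + 1))| * ((((L ^ r * L ^ kk : ℕ) : ℝ)) ^ (d + 1))⁻¹ = aK a₀ (L : ℝ) (r + kk) := by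
    rw [abs_of_pos (by positivity), mul_assoc, mul_inv_cancel₀ (by positivity), mul_one]
  have hP'row : HasMaj (BlockNorm.ofBlocks (unitTorusGeo L kk (cvM d L mv kk hL)) (liftBlk (scBlk d L mv kk hL ∘ kingPr L kk r (cvM d L mv kk hL)) ι)) (BlockNorm.ofBlocks (unitTorusGeo L kk (cvM d L mv kk hL)) (liftBlk (scBlk d L mv kk hL ∘ kingPr L kk r (cvM d L mv kk hL)) ι)) (scP' d L mv kk r hL (aK a₀ (L : ℝ) (r + kk) * (((L ^ r * L ^ kk : ℕ) : ℝ)) ^ (d + 1)) ι e U') (fun y y' => (a₀ * (Fintype.card ι : ℝ) ^ 2) * Real.exp (-(δ * (unitTorusGeo L kk (cvM d L mv kk hL)).dist y y'))) := by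
    have h := hasMaj_scP'_of_unitary (d := d) ι e he hU' (aK a₀ (L : ℝ) (r + kk) * (((L ^ r * L ^ kk : ℕ) : ℝ)) ^ (d + 1)) δ
    rw [show ScNorm' d L mv kk r hL ι = BlockNorm.ofBlocks (unitTorusGeo L kk (cvM d L mv kk hL)) (liftBlk (scBlk d L mv kk hL ∘ kingPr L kk r (cvM d L mv kk hL)) ι) from congrArg (BlockNorm.ofBlocks (unitTorusGeo L kk (cvM d L mv kk hL))) hlift] at h
    refine h.mono fun y y' => ?_
    rw [haF]
    have : aK a₀ (L : ℝ) (r + kk) * (Fintype.card ι : ℝ) ^ 2 ≤ a₀ * (Fintype.card ι : ℝ) ^ 2 := by gcongr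
    exact mul_le_mul_of_nonneg_right this (Real.exp_nonneg _)
  have hA' : ∀ k : (Fin (d + 1) → ZMod (2 * L)), HasMaj (BlockNorm.ofBlocks (unitTorusGeo L kk (cvM d L mv kk hL)) (liftBlk (scBlk d L mv kk hL ∘ kingPr L kk r (cvM d L mv kk hL)) ι)) (BlockNorm.ofBlocks (unitTorusGeo L kk (cvM d L mv kk hL)) (liftBlk (scBlk d L mv kk hL ∘ kingPr L kk r (cvM d L mv kk hL)) ι)) (mulOp (fun p : ScX' d L mv kk r hL × ι => scPsi' d L mv kk r hL k p.1) ∘ₗ (scP' d L mv kk r hL (aK a₀ (L : ℝ) (r + kk) * (((L ^ r * L ^ kk : ℕ) : ℝ)) ^ (d + 1)) ι e U' ∘ₗ mulOp (fun p : ScX' d L mv kk r hL × ι => scH' d L mv kk r hL k p.1))) (fun y y' => (a₀ * (Fintype.card ι : ℝ) ^ 2) * Real.exp (-(δ * (unitTorusGeo L kk (cvM d L mv kk hL)).dist y y'))) := fun k => by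
    have h1 := hasMaj_comp_mulOp_cut (b₂ := BlockNorm.ofBlocks (unitTorusGeo L kk (cvM d L mv kk hL)) (liftBlk (scBlk d L mv kk hL ∘ kingPr L kk r (cvM d L mv kk hL)) ι)) (liftBlk (scBlk d L mv kk hL ∘ kingPr L kk r (cvM d L mv kk hL)) ι) hEXP0 (χ := (fun p : ScX' d L mv kk r hL × ι => scH' d L mv kk r hL k p.1)) (S := (Set.univ : Set (Tor (cvM d L mv kk hL)))) (hh1le k) (fun _ _ => Set.mem_univ _) hP'row
    have h2 := hasMaj_mulOp_comp_of_abs_le_one (liftBlk (scBlk d L mv kk hL ∘ kingPr L kk r (cvM d L mv kk hL)) ι) (m := (fun p : ScX' d L mv kk r hL × ι => scPsi' d L mv kk r hL k p.1)) (hψ1le k)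
      (fun y y' => show (0 : ℝ) ≤ ind (g := unitTorusGeo L kk (cvM d L mv kk hL)) (Set.univ : Set (Tor (cvM d L mv kk hL))) y' * ((a₀ * (Fintype.card ι : ℝ) ^ 2) * Real.exp (-(δ * (unitTorusGeo L kk (cvM d L mv kk hL)).dist y y'))) from mul_nonneg (ind_nonneg (g := unitTorusGeo L kk (cvM d L mv kk hL)) Set.univ y') (hEXP0 y y')) h1
    refine h2.mono fun y y' => ?_
    rw [hind, one_mul]
  -- (2) the partition's own twisted defect through `τ_S` (n15-c∕333; the stair columns are orthogonal, the fit is n15-c∕339's `o_h`)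
  have hcvT : ∀ μ (q : ScX' d L mv kk r hL × Fin (d + 1)), (cvT e U' μ q.1)ᵀ * cvT e U' μ q.1 = 1 := fun μ q => (uN_coordMat_conj_orthogonal e he (hU' μ q.1)).1
  have hfit1 : ∀ (k : (Fin (d + 1) → ZMod (2 * L))) (p : ScX' d L mv kk r hL × ι), |(fun p : ScX' d L mv kk r hL × ι => scH' d L mv kk r hL k p.1) p - (fun p : ScX d L mv kk hL × ι => scH d L mv kk hL k p.1) (liftMap (kingPr L kk r (cvM d L mv kk hL)) ι p)| ≤ (Real.pi * (d + 1) / (((L ^ kk : ℕ) : ℝ) * ((L ^ mv : ℕ) : ℝ))) := fun k p =>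
    abs_scH'_sub_scH_kingPr_le ι hM hw k p
  have hDh : ∀ k : (Fin (d + 1) → ZMod (2 * L)), HasMaj (ScNorm d L mv kk hL ι) (BlockNorm.ofBlocks (unitTorusGeo L kk (cvM d L mv kk hL)) (liftBlk (scBlk d L mv kk hL ∘ kingPr L kk r (cvM d L mv kk hL)) ι)) (idef (ctauS (cvM d L mv kk hL) L kk r (cvT e U')) (ctauS (cvM d L mv kk hL) L kk r (cvT e U')) (mulOp (fun p : ScX' d L mv kk r hL × ι => scH' d L mv kk r hL k p.1)) (mulOp (fun p : ScX d L mv kk hL × ι => scH d L mv kk hL k p.1))) (diagK fun _ => (Fintype.card ι : ℝ) * (Real.pi * (d + 1) / (((L ^ kk : ℕ) : ℝ) * ((L ^ mv : ℕ) : ℝ)))) := fun k =>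
    hasMaj_idef_mulOp_tr (g := unitTorusGeo L kk (cvM d L mv kk hL)) (scBlk d L mv kk hL) (kingPr L kk r (cvM d L mv kk hL)) (ctauS (cvM d L mv kk hL) L kk r (cvT e U')) (ctauS_eq_mmulOp_pull (cvM d L mv kk hL) L kk r (cvT e U'))
      (fun x' i j => abs_kingStairT_transpose_le_one (cvM d L mv kk hL) (L ^ r * L ^ kk) (L ^ r) hcvT (x', 0) i j) hOHo0 (hfit1 k)
  have hT1 : ∀ k : (Fin (d + 1) → ZMod (2 * L)), HasMaj (ScNorm d L mv kk hL ι) (BlockNorm.ofBlocks (unitTorusGeo L kk (cvM d L mv kk hL)) (liftBlk (scBlk d L mv kk hL ∘ kingPr L kk r (cvM d L mv kk hL)) ι)) ((mulOp (fun p : ScX' d L mv kk r hL × ι => scPsi' d L mv kk r hL k p.1) ∘ₗ (scP' d L mv kk r hL (aK a₀ (L : ℝ) (r + kk) * (((L ^ r * L ^ kk : ℕ) : ℝ)) ^ (d + 1)) ι e U' ∘ₗ mulOp (fun p : ScX' d L mv kk r hL × ι => scH' d L mv kk r hL k p.1))) ∘ₗ idef (ctauS (cvM d L mv kk hL) L kk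 r (cvT e U')) (ctauS (cvM d L mv kk hL) L kk r (cvT e U')) (mulOp (fun p : ScX' d L mv kk r hL × ι => scH' d L mv kk r hL k p.1)) (mulOp (fun p : ScX d L mv kk hL × ι => scH d L mv kk hL k p.1)))
      (fun y y' => ((a₀ * (Fintype.card ι : ℝ) ^ 2) * (Fintype.card ι * (Real.pi * (d + 1) / (((L ^ kk : ℕ) : ℝ) * ((L ^ mv : ℕ) : ℝ))))) * Real.exp (-(δ * (unitTorusGeo L kk (cvM d L mv kk hL)).dist y y'))) := fun k => by
    have hc := B11SectG.hasMaj_comp (hA' k) (hDh k) hEXP0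
    refine hc.mono fun y y' => ?_
    have hκ1 : (BlockNorm.ofBlocks (unitTorusGeo L kk (cvM d L mv kk hL)) (liftBlk (scBlk d L mv kk hL ∘ kingPr L kk r (cvM d L mv kk hL)) ι)).κ = 1 := rfl
    rw [hκ1, Finset.sum_eq_single y' (fun y'' _ hne => by rw [diagK_ne _ hne]; ring) (fun h => absurd (Finset.mem_univ y') h), diagK_same]
    exact le_of_eq (by ring)
  -- (3) the cube pieces (n15-c∕378) behind the coarse partition cut
  have hT2 : ∀ k : (Fin (d + 1) → ZMod (2 * L)), HasMaj (ScNorm d L mv kk hL ι) (BlockNorm.ofBlocks (unitTorusGeo L kk (cvM d L mv kk hL)) (liftBlk (scBlk d L mv kk hL ∘ kingPr L kk r (cvM d L mv kk hL)) ι)) (idef (ctauS (cvM d L mv kk hL) L kk r (cvT e U')) (ctauS (cvM d L mv kk hL) L kk r (cvT e U')) (mulOp (fun p : ScX' d L mv kk r hL × ι => scPsi' d L mv kk r hL k p.1) ∘ₗ (scP' d L mv kk r hL (aK a₀ (L : ℝ) (r + kk) * (((L ^ r * L ^ kk : ℕ) : ℝ)) ^ (d + 1)) ι e U' ∘ₗ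 mulOp (fun p : ScX' d L mv kk r hL × ι => scH' d L mv kk r hL k p.1))) (mulOp (fun p : ScX d L mv kk hL × ι => scPsi d L mv kk hL k p.1) ∘ₗ (scP d L mv kk hL (aK a₀ (L : ℝ) kk * (((L ^ kk : ℕ) : ℝ)) ^ (d + 1)) ι e U ∘ₗ mulOp (fun p : ScX d L mv kk hL × ι => scH d L mv kk hL k p.1))) ∘ₗ mulOp (fun p : ScX d L mv kk hL × ι => scH d L mv kk hL k p.1))
      (fun y y' => ((Fintype.card ι : ℝ) ^ 2 * (((4 / 3 * a₀ * ((L : ℝ) ^ kk) ^ (-(2 : ℝ))) + (Fintype.card ι * (|aK a₀ (L : ℝ) (r + kk) - aK a₀ (L : ℝ) kk| * (1 + Fintype.card ι) + |aK a₀ (L : ℝ) kk| * (2 * Fintype.card ι * (@basisConst ι _ (Matrix mm mm ℂ) Matrix.frobeniusNormedAddCommGroup Matrix.frobeniusNormedSpace e * (2 * Real.sqrt (Fintype.card mm)) * (Real.sqrt (Fintype.card mm) * ((d + 1) * (d * ((((L ^ r * L ^ kk : ℕ) : ℝ)) * (((L ^ r : ℕ) : ℝ) * b)) + ((1 + ρ)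 ^ (L ^ r) - 1)))))))) + ((a₀ * (Fintype.card ι : ℝ) ^ 2) * (Fintype.card ι * (Real.pi * (d + 1) / (((L ^ kk : ℕ) : ℝ) * ((L ^ mv : ℕ) : ℝ)))))) + ((1 + (Fintype.card ι * (@basisConst ι _ (Matrix mm mm ℂ) Matrix.frobeniusNormedAddCommGroup Matrix.frobeniusNormedSpace e * (2 * Real.sqrt (Fintype.card mm)) * (Real.sqrt (Fintype.card mm) * ρ)))) ^ ((d + 1) * (L ^ r - 1)) - 1) * (a₀ * (Fintype.card ι : ℝ) ^ 2) + ((1 + (Fintype.card ι * (@basisConst ι _ (Matrix mm mm ℂ) Matrix.frobeniusNormedAddCommGroup Matrix.frobeniusNormedSpace e * (2 * Real.sqrt (Fintype.card mm)) * (Real.sqrt (Fintype.card mm) * ρ)))) ^ ((d + 1) * (L ^ r - 1)) - 1) * (a₀ * (Fintype.card ι : ℝ) ^ 2))) * Real.exp (-(δ * (unitTorusGeo L kk (cvM d L mv kk hL)).dist y y'))) := fun k => by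
    have h378 := hasMaj_idef_ctauS_scP_piece ι e hM hm₁ hfitI hS0 hw hL2 hkk he ha₀ u' hu' U' hU' U hpair hρ hb hρk hbk hδ k (hχh k) (hχh' k)
    have h1 := hasMaj_comp_mulOp_cut (b₂ := BlockNorm.ofBlocks (unitTorusGeo L kk (cvM d L mv kk hL)) (liftBlk (scBlk d L mv kk hL ∘ kingPr L kk r (cvM d L mv kk hL)) ι)) (liftBlk (scBlk d L mv kk hL) ι) (fun y y' => show (0 : ℝ) ≤ ((Fintype.card ι : ℝ) ^ 2 * (((4 / 3 * a₀ * ((L : ℝ) ^ kk) ^ (-(2 : ℝ))) + (Fintype.card ι * (|aK a₀ (L : ℝ) (r + kk) - aK a₀ (L : ℝ) kk| * (1 + Fintype.card ι) + |aK a₀ (L : ℝ) kk| * (2 * Fintype.card ι * (@basisConst ι _ (Matrix mm mm ℂ) Matrix.frobeniusNormedAddCommGroup Matrix.frobeniusNormedSpace e * (2 * Real.sqrt (Fintype.card mm)) * (Real.sqrt (Fintype.card mm) * ((d + 1) * (d * ((((L ^ r * L ^ kk : ℕ) : ℝ)) * (((L ^ r : ℕ) : ℝ) * b)) + ((1 +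 ρ) ^ (L ^ r) - 1)))))))) + ((a₀ * (Fintype.card ι : ℝ) ^ 2) * (Fintype.card ι * (Real.pi * (d + 1) / (((L ^ kk : ℕ) : ℝ) * ((L ^ mv : ℕ) : ℝ)))))) + ((1 + (Fintype.card ι * (@basisConst ι _ (Matrix mm mm ℂ) Matrix.frobeniusNormedAddCommGroup Matrix.frobeniusNormedSpace e * (2 * Real.sqrt (Fintype.card mm)) * (Real.sqrt (Fintype.card mm) * ρ)))) ^ ((d + 1) * (L ^ r - 1)) - 1) * (a₀ * (Fintype.card ι : ℝ) ^ 2) + ((1 + (Fintype.card ι * (@basisConst ι _ (Matrix mm mm ℂ) Matrix.frobeniusNormedAddCommGroup Matrix.frobeniusNormedSpace e * (2 * Real.sqrt (Fintype.card mm)) * (Real.sqrt (Fintype.card mm) * ρ)))) ^ ((d + 1) * (L ^ r - 1)) - 1) * (a₀ * (Fintype.card ι : ℝ) ^ 2))) * Real.exp (-(δ * (unitTorusGeo L kk (cvM d L mv kk hL)).dist y y')) from mul_nonneg hPIECE0 (Real.exp_nonneg _))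
      (χ := (fun p : ScX d L mv kk hL × ι => scH d L mv kk hL k p.1)) (S := (Set.univ : Set (Tor (cvM d L mv kk hL)))) (hhle k) (fun _ _ => Set.mem_univ _) h378
    refine h1.mono fun y y' => ?_
    rw [hind, one_mul]
  -- (4) per cube: `𝔇(A′M_{h′}, AM_h) = A′𝔇(M_{h′}, M_h) + 𝔇(A′, A)M_h`
  have hTk : ∀ k : (Fin (d + 1) → ZMod (2 * L)), HasMaj (ScNorm d L mv kk hL ι) (BlockNorm.ofBlocks (unitTorusGeo L kk (cvM d L mv kk hL)) (liftBlk (scBlk d L mv kk hL ∘ kingPr L kk r (cvM d L mv kk hL)) ι))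
      (idef (ctauS (cvM d L mv kk hL) L kk r (cvT e U')) (ctauS (cvM d L mv kk hL) L kk r (cvT e U')) ((mulOp (fun p : ScX' d L mv kk r hL × ι => scPsi' d L mv kk r hL k p.1) ∘ₗ (scP' d L mv kk r hL (aK a₀ (L : ℝ) (r + kk) * (((L ^ r * L ^ kk : ℕ) : ℝ)) ^ (d + 1)) ι e U' ∘ₗ mulOp (fun p : ScX' d L mv kk r hL × ι => scH' d L mv kk r hL k p.1))) ∘ₗ mulOp (fun p : ScX' d L mv kk r hL × ι => scH' d L mv kk r hL k p.1)) ((mulOp (fun p : ScX d L mv kk hL × ι => scPsi d L mv kk hL k p.1) ∘ₗ (scP d L mv kk hL (aK a₀ (L : ℝ) kk * (((L ^ kk : ℕ) : ℝ)) ^ (d + 1)) ι e U ∘ₗ mulOp (fun p : ScX d L mv kk hL × ι => scH d L mv kk hL k p.1))) ∘ₗ mulOp (fun p : ScX d L mv kk hL × ι => scH d L mv kk hL k p.1)))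
      (fun y y' => (((a₀ * (Fintype.card ι : ℝ) ^ 2) * (Fintype.card ι * (Real.pi * (d + 1) / (((L ^ kk : ℕ) : ℝ) * ((L ^ mv : ℕ) : ℝ))))) + ((Fintype.card ι : ℝ) ^ 2 * (((4 / 3 * a₀ * ((L : ℝ) ^ kk) ^ (-(2 : ℝ))) + (Fintype.card ι * (|aK a₀ (L : ℝ) (r + kk) - aK a₀ (L : ℝ) kk| * (1 + Fintype.card ι) + |aK a₀ (L : ℝ) kk| * (2 * Fintype.card ι * (@basisConst ι _ (Matrix mm mm ℂ) Matrix.frobeniusNormedAddCommGroup Matrix.frobeniusNormedSpace e * (2 * Real.sqrt (Fintype.card mm)) * (Real.sqrt (Fintype.card mm) * ((d + 1) * (d * ((((L ^ r * L ^ kk : ℕ) : ℝ)) * (((L ^ r : ℕ) : ℝ) * b)) + ((1 + ρ) ^ (L ^ r) - 1)))))))) + ((a₀ * (Fintype.card ι : ℝ) ^ 2) * (Fintype.card ι * (Real.pi * (d + 1) / (((L ^ kk : ℕ) : ℝ) * ((L ^ mv : ℕ) : ℝ)))))) + ((1 + (Fintype.card ι * (@basisConst ι _ (Matrix mm mm ℂ)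 Matrix.frobeniusNormedAddCommGroup Matrix.frobeniusNormedSpace e * (2 * Real.sqrt (Fintype.card mm)) * (Real.sqrt (Fintype.card mm) * ρ)))) ^ ((d + 1) * (L ^ r - 1)) - 1) * (a₀ * (Fintype.card ι : ℝ) ^ 2) + ((1 + (Fintype.card ι * (@basisConst ι _ (Matrix mm mm ℂ) Matrix.frobeniusNormedAddCommGroup Matrix.frobeniusNormedSpace e * (2 * Real.sqrt (Fintype.card mm)) * (Real.sqrt (Fintype.card mm) * ρ)))) ^ ((d + 1) * (L ^ r - 1)) - 1) * (a₀ * (Fintype.card ι : ℝ) ^ 2)))) * Real.exp (-(δ * (unitTorusGeo L kk (cvM d L mv kk hL)).dist y y'))) := fun k => by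
    rw [idef_comp (ctauS (cvM d L mv kk hL) L kk r (cvT e U')) (ctauS (cvM d L mv kk hL) L kk r (cvT e U')) (ctauS (cvM d L mv kk hL) L kk r (cvT e U'))]
    refine ((hT1 k).add (hT2 k)).mono fun y y' => ?_
    exact le_of_eq (by ring)
  -- (5) sum over the cube classes
  rw [scP'_decomp ι e hM hw hfit hK2 (aK a₀ (L : ℝ) (r + kk) * (((L ^ r * L ^ kk : ℕ) : ℝ)) ^ (d + 1)) U', scP_decomp ι e hM hw hfit hK2 (aK a₀ (L : ℝ) kk * (((L ^ kk : ℕ) : ℝ)) ^ (d + 1)) U, DerivDefect.idef_finset_sum]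
  refine (DerivDefect.hasMaj_finset_sum Finset.univ fun k _ => hTk k).mono fun y y' => ?_
  rw [Finset.sum_const, Finset.card_univ, nsmul_eq_mul]
  exact le_of_eq (by ring)

end Summit.QuantumFields.YangMills.BalabanUVNodes.N15.Gluing

end
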